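/-
Copyright (c) 2026 the pub-hodgecm-mathlib formalisation cell (harness21).  Prover seat hodgecm-mathlib-B-p14 (g33), 2026-09-01.  Opportunistic brick
«R1LL-WILD (W′2)» (A-p12 (g19) census `F0/P3a/A-p12/g19/CENSUS-R1LL-wild` 822e2006 §2; LEAD F0P3a-plan (g10) WORD T9-22 (4)), PURE PART: transport of
fixed cosets, their counts and fixed-point sums along the orbit map of a transitive action (vertices ∕ edges of a graph).
-/
import Mathlib.GroupTheory.GroupAction.Quotient
import Mathlib.Data.Set.Card
import Mathlib.Algebra.BigOperators.Finprod
import Mathlib.Combinatorics.SimpleGraph.Basic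
import Mathlib.Tactic.Group
import HarnessLib

/-!
# Transport of fixed cosets and fixed-point sums along the orbit map of a transitive action
# `Σᶠ_{q ∈ Fix_γ(Γ ⧸ K)} F q.out = Σᶠ_{x ∈ Fix_X(γ)} val x`

Topic `GroupTheory`; namespace `Literature.GroupTheory` (sibling of ★ `CosetSpaceMulEquivCongr`, which transports between two COSET SPACES along a group
ISOMORPHISM — here the target is the set of fixed POINTS of a `Γ`-set, reached along an ORBIT MAP).  THEOREMS ONLY (no definition, no instance, no notation, no
named fact, no `sorry`); Mathlib-only; kernel lane.  Cell `pub/hodgecm-mathlib`, crux H413 = stmt-HodgeConjecture-24833; the pure half of the opportunistic brick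
«R1LL-WILD (W′2)» (the orbital-integral readings are `NumberTheory/Automorphic/OrbitalIntegralFixedPointWeightedAction`).
HONEST LABEL: HC_CM is proved only modulo the cell's remaining named inputs (hLiu418, h413) until rung 0 closes; this file is elementary group theory and cites
print only for orientation.

THE MATHEMATICS [Serre1980Trees I.6.1; Kottwitz1986 §3].  Let `K ≤ Γ` and let `f : Γ → X` be an ORBIT MAP: `f a = f b ↔ a⁻¹ b ∈ K` (so `K` is the stabiliser of
`f 1` and `f` is constant exactly on left cosets) and `f` surjective (one orbit); let `T : X → X` be «the action of `γ`»: `f (γ g) = T (f g)`.  Then `gK ↦ f g` is an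
equivariant bijection `Γ ⧸ K ≃ X` (orbit–stabiliser), the `γ`-fixed cosets go to the `T`-fixed points, and for ANY summand `F : Γ → E` and ANY value law
`val : X → E` with `F g = val (f g)` whenever `T` fixes `f g`,
  `Σᶠ_{q ∈ Fix_γ(Γ ⧸ K)} F q.out = Σᶠ_{x ∈ Fix_X(T)} val x`
— the hypothesis is used only at the representatives `q.out`, whose images are fixed; no section of `f` is chosen.  With `F g = φ (g⁻¹ γ g)` this is the summand
of the finite-group unfolding of an orbital integral [Kottwitz1986 §3; Rogawski1990 §4.9 p. 54], and `val` is «the class of `γ` read at the fixed vertex `f g`»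
[LabesseLanglands1979 §2 p. 8: the vertices `diag(1, ϖ^m)·v₀` of the tree of `SL₂`].  §2 spells the same for an action given on points — `act : Γ → W → W` with
`act 1 = id`, `act (g h) = act g ∘ act h`, the shape in which a matrix group acts on a lattice tree (★ `glVertexAct`) — on VERTICES (`g ∈ Kv ↔ act g x₀ = x₀`, one orbit)
and on GEOMETRIC EDGES of a graph (`g ∈ Ke ↔ {act g x₀, act g x₁} = {x₀, x₁}` SET-WISE, one dart orbit), with binders verbatim those of ★
`TreeAction.natCard_fixedBy_add_eq_natCard_fixedBy_add_one_of_vertexAction` (whose §1 `nonempty_fixedBy_quotient_equiv` is the COUNT-only ancestor of this file).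

* §1 `exists_equiv_quotient_orbitMap`, `equiv_quotient_orbitMap_smul`, `mem_fixedBy_quotient_iff_orbitMap`, `image_fixedBy_quotient_orbitMap_eq`,
  **`finsum_mem_fixedBy_quotient_eq_finsum_fixedPoints`** (value-law form), `…_conj_…` (`F g = φ (g⁻¹ γ g)`), `…_conj_…_section` (any section, `φ` invariant under
  `K`-conjugation), `finite_fixedBy_quotient_iff_orbitMap`, `ncard_fixedBy_quotient_eq_orbitMap`, `ncard_sep_fixedBy_quotient_eq_orbitMap` (stratified counts).
* §2.1 vertices: `finsum_mem_fixedBy_quotient_conj_eq_finsum_fixedPoints_of_vertexAction` (+ `_section_`), `finite_…`, `ncard_…`, `ncard_sep_…_of_vertexAction`.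
* §2.2 edges: `finsum_mem_fixedBy_quotient_conj_eq_finsum_fixedEdges_of_edgeAction`, `finite_…`, `ncard_…_of_edgeAction`.

## References
* [Serre1980Trees] J.-P. Serre, *Trees* (1980): Ch. I §6.1 (orbit–stabiliser, fixed points), Ch. II §1.2–1.3 (the tree of `SL₂`, inversions).
* [Kottwitz1986] R. E. Kottwitz, *Base change for unit elements of Hecke algebras*, Compositio Math. 60 (1986): §3.
* [Rogawski1990] J. D. Rogawski, *Automorphic Representations of Unitary Groups in Three Variables*, Ann. of Math. Stud. 123 (1990): §4.9 p. 54.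
* [LabesseLanglands1979] J.-P. Labesse, R. P. Langlands, *L-indistinguishability for SL(2)*, Canad. J. Math. 31 (1979): §2 p. 8.
-/

set_option autoImplicit false

open Set Function MulAction

namespace Literature.GroupTheory

/-! ## §1 Orbit-map transport of fixed-point sums (pure group theory) -/

section OrbitMap

variable {Γ : Type*} [Group Γ] (K : Subgroup Γ) (γ : Γ) {X : Type*}
  (f : Γ → X) (hf : ∀ a b : Γ, f a = f b ↔ a⁻¹ * b ∈ K) (hs : Function.Surjective f)

include hf hs in
/-- **The orbit map descends to a bijection `Γ ⧸ K ≃ X`, `gK ↦ f g`** (orbit–stabiliser: `f a = f b ↔ a⁻¹ b ∈ K` says `K` is the stabiliser of `f 1` and `f` is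
constant exactly on left `K`-cosets). [cite: Serre1980Trees, I.6.1] -/
theorem exists_equiv_quotient_orbitMap : ∃ Φ : Γ ⧸ K ≃ X, ∀ g : Γ, Φ (QuotientGroup.mk g) = f g := by
  let F : Γ ⧸ K → X := Quotient.lift f fun a b (hab : QuotientGroup.leftRel K a b) => (hf a b).2 (QuotientGroup.leftRel_apply.1 hab)
  have hF : ∀ g : Γ, F (QuotientGroup.mk g) = f g := fun _ => rfl
  have hFinj : Function.Injective F := by
    intro p q hpq
    induction p using QuotientGroup.induction_on with
    | H a =>
      induction q using QuotientGroup.induction_on with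
      | H b => exact QuotientGroup.eq.2 ((hf a b).1 hpq)
  have hFsurj : Function.Surjective F := fun x => by
    obtain ⟨g, rfl⟩ := hs x
    exact ⟨QuotientGroup.mk g, rfl⟩
  exact ⟨Equiv.ofBijective F ⟨hFinj, hFsurj⟩, hF⟩

/-- The descended bijection is equivariant: `Φ (γ • q) = T (Φ q)` when `T` is «the action of `γ` on `X`» (`f (γ g) = T (f g)`). [cite: Serre1980Trees, I.6.1] -/
theorem equiv_quotient_orbitMap_smul (Φ : Γ ⧸ K ≃ X) (hΦ : ∀ g : Γ, Φ (QuotientGroup.mk g) = f g)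
    (T : X → X) (hT : ∀ g : Γ, f (γ * g) = T (f g)) (q : Γ ⧸ K) : Φ (γ • q) = T (Φ q) := by
  induction q using QuotientGroup.induction_on with
  | H g => rw [MulAction.Quotient.smul_mk, smul_eq_mul, hΦ, hΦ, hT]

/-- Fixed cosets correspond to fixed points: `q ∈ Fix_γ(Γ ⧸ K) ↔ T (Φ q) = Φ q`. [cite: Serre1980Trees, I.6.1] -/
theorem mem_fixedBy_quotient_iff_orbitMap (Φ : Γ ⧸ K ≃ X) (hΦ : ∀ g : Γ, Φ (QuotientGroup.mk g) = f g)
    (T : X → X) (hT : ∀ g : Γ, f (γ * g) = T (f g)) (q : Γ ⧸ K) : q ∈ fixedBy (Γ ⧸ K) γ ↔ T (Φ q) = Φ q := by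
  rw [MulAction.mem_fixedBy, ← equiv_quotient_orbitMap_smul K γ f Φ hΦ T hT, Φ.apply_eq_iff_eq]

/-- `Φ '' Fix_γ(Γ ⧸ K) = Fix_X(T)`. [cite: Serre1980Trees, I.6.1] -/
theorem image_fixedBy_quotient_orbitMap_eq (Φ : Γ ⧸ K ≃ X) (hΦ : ∀ g : Γ, Φ (QuotientGroup.mk g) = f g)
    (T : X → X) (hT : ∀ g : Γ, f (γ * g) = T (f g)) : Φ '' fixedBy (Γ ⧸ K) γ = {x : X | T x = x} := by
  ext x
  constructor
  · rintro ⟨q, hq, rfl⟩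
    exact (mem_fixedBy_quotient_iff_orbitMap K γ f Φ hΦ T hT q).1 hq
  · intro hx
    exact ⟨Φ.symm x, (mem_fixedBy_quotient_iff_orbitMap K γ f Φ hΦ T hT _).2 (by simpa using hx), Φ.apply_symm_apply x⟩

/-- The value of the descended bijection at a coset is the orbit map at its chosen representative: `Φ q = f q.out`. [cite: Serre1980Trees, I.6.1] -/
theorem equiv_quotient_orbitMap_apply_eq_apply_out (Φ : Γ ⧸ K ≃ X) (hΦ : ∀ g : Γ, Φ (QuotientGroup.mk g) = f g) (q : Γ ⧸ K) :
    Φ q = f q.out := by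
  conv_lhs => rw [← QuotientGroup.out_eq' q]
  exact hΦ q.out

include hf hs in
/-- **ORBIT-MAP TRANSPORT OF A FIXED-POINT SUM — VALUE-LAW FORM.**  Along an orbit map `f : Γ → X` (`f a = f b ↔ a⁻¹ b ∈ K`, surjective) intertwining `γ` with
`T`, for ANY summand `F : Γ → E` and ANY value law `val : X → E` such that `F g = val (f g)` whenever `T` fixes `f g`:
`Σᶠ_{q ∈ Fix_γ(Γ ⧸ K)} F q.out = Σᶠ_{x ∈ Fix_X(T)} val x`.  (No section of `f` is chosen and no invariance of `F` is asked: the hypothesis is only ever used at the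
representatives `q.out`, whose images ARE fixed.) [cite: Kottwitz1986, §3] [cite: Serre1980Trees, I.6.1] -/
theorem finsum_mem_fixedBy_quotient_eq_finsum_fixedPoints {E : Type*} [AddCommMonoid E] (T : X → X) (hT : ∀ g : Γ, f (γ * g) = T (f g))
    (F : Γ → E) (val : X → E) (hval : ∀ g : Γ, T (f g) = f g → F g = val (f g)) :
    ∑ᶠ q ∈ fixedBy (Γ ⧸ K) γ, F q.out = ∑ᶠ x ∈ {x : X | T x = x}, val x := by
  obtain ⟨Φ, hΦ⟩ := exists_equiv_quotient_orbitMap K f hf hs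
  have hΦout : ∀ q : Γ ⧸ K, Φ q = f q.out := equiv_quotient_orbitMap_apply_eq_apply_out K f Φ hΦ
  calc ∑ᶠ q ∈ fixedBy (Γ ⧸ K) γ, F q.out
      = ∑ᶠ q ∈ fixedBy (Γ ⧸ K) γ, val (Φ q) := by
        refine finsum_mem_congr rfl fun q hq => ?_
        have hfix : T (f q.out) = f q.out := by
          rw [← hΦout]
          exact (mem_fixedBy_quotient_iff_orbitMap K γ f Φ hΦ T hT q).1 hq
        rw [hval q.out hfix, hΦout]
    _ = ∑ᶠ x ∈ Φ '' fixedBy (Γ ⧸ K) γ, val x := (finsum_mem_image Φ.injective.injOn).symm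
    _ = ∑ᶠ x ∈ {x : X | T x = x}, val x := by rw [image_fixedBy_quotient_orbitMap_eq K γ f Φ hΦ T hT]

include hf hs in
/-- **The conjugation summand** `F g = φ (g⁻¹ γ g)` (the summand of ★ `integral_conj_eq_smul_finsum_fixedBy`): under a value law
`T (f g) = f g → φ (g⁻¹ γ g) = val (f g)` («the class of `γ` read at the fixed point `f g`»),
`Σᶠ_{q ∈ Fix_γ(Γ ⧸ K)} φ (q.out⁻¹ γ q.out) = Σᶠ_{x ∈ Fix_X(T)} val x`. [cite: Kottwitz1986, §3] [cite: Rogawski1990, §4.9 p. 54] -/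
theorem finsum_mem_fixedBy_quotient_conj_eq_finsum_fixedPoints {E : Type*} [AddCommMonoid E] (T : X → X) (hT : ∀ g : Γ, f (γ * g) = T (f g))
    (φ : Γ → E) (val : X → E) (hval : ∀ g : Γ, T (f g) = f g → φ (g⁻¹ * γ * g) = val (f g)) :
    ∑ᶠ q ∈ fixedBy (Γ ⧸ K) γ, φ (q.out⁻¹ * γ * q.out) = ∑ᶠ x ∈ {x : X | T x = x}, val x :=
  finsum_mem_fixedBy_quotient_eq_finsum_fixedPoints K γ f hf hs T hT (fun g => φ (g⁻¹ * γ * g)) val hval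

include hf hs in
/-- **The section form**: for `φ` invariant under `K`-conjugation and ANY section `s` of the orbit map (`f (s x) = x`),
`Σᶠ_{q ∈ Fix_γ(Γ ⧸ K)} φ (q.out⁻¹ γ q.out) = Σᶠ_{x ∈ Fix_X(T)} φ ((s x)⁻¹ γ (s x))` — at a fixed `x = f g` one has `g = s x · k` with `k ∈ K`, and
`φ (g⁻¹ γ g) = φ (k⁻¹ ((s x)⁻¹ γ (s x)) k)`. [cite: Kottwitz1986, §3] [cite: Rogawski1990, §4.9 p. 54] -/
theorem finsum_mem_fixedBy_quotient_conj_eq_finsum_fixedPoints_section {E : Type*} [AddCommMonoid E] (T : X → X)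
    (hT : ∀ g : Γ, f (γ * g) = T (f g)) (φ : Γ → E) (hφK : ∀ k ∈ K, ∀ y : Γ, φ (k * y * k⁻¹) = φ y)
    (s : X → Γ) (hsec : ∀ x : X, f (s x) = x) :
    ∑ᶠ q ∈ fixedBy (Γ ⧸ K) γ, φ (q.out⁻¹ * γ * q.out) = ∑ᶠ x ∈ {x : X | T x = x}, φ ((s x)⁻¹ * γ * s x) := by
  refine finsum_mem_fixedBy_quotient_conj_eq_finsum_fixedPoints K γ f hf hs T hT φ (fun x => φ ((s x)⁻¹ * γ * s x)) fun g _ => ?_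
  -- `g = s (f g) · k` with `k = (s (f g))⁻¹ g ∈ K`
  have hk : (s (f g))⁻¹ * g ∈ K := (hf _ _).1 (hsec (f g))
  have hconj : g⁻¹ * γ * g = ((s (f g))⁻¹ * g)⁻¹ * ((s (f g))⁻¹ * γ * s (f g)) * ((s (f g))⁻¹ * g)⁻¹⁻¹ := by group
  rw [hconj, hφK _ (K.inv_mem hk)]

include hf hs in
/-- Finitely many fixed cosets iff finitely many fixed points. [cite: Serre1980Trees, I.6.1] -/
theorem finite_fixedBy_quotient_iff_orbitMap (T : X → X) (hT : ∀ g : Γ, f (γ * g) = T (f g)) :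
    (fixedBy (Γ ⧸ K) γ).Finite ↔ {x : X | T x = x}.Finite := by
  obtain ⟨Φ, hΦ⟩ := exists_equiv_quotient_orbitMap K f hf hs
  rw [← image_fixedBy_quotient_orbitMap_eq K γ f Φ hΦ T hT, Set.finite_image_iff Φ.injective.injOn]

include hf hs in
/-- The fixed-point COUNT read on `X`: `#Fix_γ(Γ ⧸ K) = #Fix_X(T)` (`Set.ncard`; the `Nat.card` currency is ★ `TreeAction.nonempty_fixedBy_quotient_equiv`).
[cite: Serre1980Trees, I.6.1] [cite: Kottwitz1986, §3] -/
theorem ncard_fixedBy_quotient_eq_orbitMap (T : X → X) (hT : ∀ g : Γ, f (γ * g) = T (f g)) :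
    (fixedBy (Γ ⧸ K) γ).ncard = {x : X | T x = x}.ncard := by
  obtain ⟨Φ, hΦ⟩ := exists_equiv_quotient_orbitMap K f hf hs
  rw [← image_fixedBy_quotient_orbitMap_eq K γ f Φ hΦ T hT, Set.ncard_image_of_injective _ Φ.injective]

include hf hs in
/-- **Stratified counts agree**: for any predicate `pr` on `X` (a depth shell, say), `#{q ∈ Fix_γ | pr (f q.out)} = #{x ∈ Fix_X(T) | pr x}` — the facet form of the
counts in ★ `integral_conj_eq_smul_depthExpansion`. [cite: Kottwitz1986, §3] [cite: Serre1980Trees, I.6.1] -/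
theorem ncard_sep_fixedBy_quotient_eq_orbitMap (T : X → X) (hT : ∀ g : Γ, f (γ * g) = T (f g)) (pr : X → Prop) :
    {q ∈ fixedBy (Γ ⧸ K) γ | pr (f q.out)}.ncard = {x : X | T x = x ∧ pr x}.ncard := by
  obtain ⟨Φ, hΦ⟩ := exists_equiv_quotient_orbitMap K f hf hs
  have hΦout : ∀ q : Γ ⧸ K, Φ q = f q.out := equiv_quotient_orbitMap_apply_eq_apply_out K f Φ hΦ
  have himg : Φ '' {q ∈ fixedBy (Γ ⧸ K) γ | pr (f q.out)} = {x : X | T x = x ∧ pr x} := by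
    ext x
    constructor
    · rintro ⟨q, ⟨hq, hpq⟩, rfl⟩
      exact ⟨(mem_fixedBy_quotient_iff_orbitMap K γ f Φ hΦ T hT q).1 hq, by rwa [hΦout]⟩
    · rintro ⟨hx, hpx⟩
      refine ⟨Φ.symm x, ⟨(mem_fixedBy_quotient_iff_orbitMap K γ f Φ hΦ T hT _).2 (by simpa using hx), ?_⟩, Φ.apply_symm_apply x⟩
      rw [← hΦout, Φ.apply_symm_apply]
      exact hpx
  rw [← himg, Set.ncard_image_of_injective _ Φ.injective]

end OrbitMap

/-! ## §2 The `act` spelling: an action given on points (vertices ∕ edges of a graph) -/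

section Action

variable {Γ : Type*} [Group Γ] {W : Type*} (act : Γ → W → W) (act_one : ∀ x : W, act 1 x = x)
  (act_mul : ∀ (g h : Γ) (x : W), act (g * h) x = act g (act h x))

include act_one act_mul in
/-- Bookkeeping (private): `act (a⁻¹ b) x = y ↔ act b x = act a y`. [folklore] -/
private theorem act_inv_mul_apply_eq_iff_of_act_one_act_mul (a b : Γ) (x y : W) : act (a⁻¹ * b) x = y ↔ act b x = act a y := by
  constructor
  · intro h
    rw [← h, ← act_mul, mul_inv_cancel_left]
  · intro h
    rw [act_mul, h, ← act_mul, inv_mul_cancel, act_one]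

include act_one act_mul in
/-- Bookkeeping (private): each `act a` is injective (its inverse is `act a⁻¹`). [folklore] -/
private theorem injective_act_of_act_one_act_mul (a : Γ) : Function.Injective (act a) := fun x y h => by
  have h' := congrArg (act a⁻¹) h
  rwa [← act_mul, ← act_mul, inv_mul_cancel, act_one, act_one] at h'

/-! ### §2.1 Vertices: `Kv = Stab(x₀)`, one orbit -/

section Vertex

variable {x₀ : W} (hV : ∀ x : W, ∃ g : Γ, act g x₀ = x) (Kv : Subgroup Γ) (hKv : ∀ g : Γ, g ∈ Kv ↔ act g x₀ = x₀) (γ : Γ)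

include act_one act_mul hKv in
/-- The orbit map `g ↦ act g x₀` has `K`-fibres: `act a x₀ = act b x₀ ↔ a⁻¹ b ∈ Kv`. [cite: Serre1980Trees, I.6.1] -/
theorem act_apply_eq_act_apply_iff_inv_mul_mem (a b : Γ) : act a x₀ = act b x₀ ↔ a⁻¹ * b ∈ Kv := by
  rw [hKv, act_inv_mul_apply_eq_iff_of_act_one_act_mul act act_one act_mul, eq_comm]

include act_one act_mul hV hKv in
/-- **THE WEIGHTED FIXED-POINT SUM READ ON THE VERTICES** (value-law form): if `φ (g⁻¹ γ g) = val (act g x₀)` whenever `γ` fixes the vertex `act g x₀`, then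
`Σᶠ_{q ∈ Fix_γ(Γ ⧸ Kv)} φ (q.out⁻¹ γ q.out) = Σᶠ_{x ∈ Fix_W(γ)} val x`, `Fix_W(γ) = {x | act γ x = x}`. [cite: Kottwitz1986, §3] [cite: Rogawski1990, §4.9 p. 54]
[cite: LabesseLanglands1979, §2 p. 8] -/
theorem finsum_mem_fixedBy_quotient_conj_eq_finsum_fixedPoints_of_vertexAction {E : Type*} [AddCommMonoid E] (φ : Γ → E) (val : W → E)
    (hval : ∀ g : Γ, act γ (act g x₀) = act g x₀ → φ (g⁻¹ * γ * g) = val (act g x₀)) :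
    ∑ᶠ q ∈ fixedBy (Γ ⧸ Kv) γ, φ (q.out⁻¹ * γ * q.out) = ∑ᶠ x ∈ {x : W | act γ x = x}, val x :=
  finsum_mem_fixedBy_quotient_conj_eq_finsum_fixedPoints Kv γ (fun g => act g x₀)
    (act_apply_eq_act_apply_iff_inv_mul_mem act act_one act_mul Kv hKv) hV (act γ) (fun g => act_mul γ g x₀) φ val hval

include act_one act_mul hV hKv in
/-- **The section form on the vertices**: for `φ` invariant under `Kv`-conjugation and ANY choice `s x` of an element moving `x₀` to `x`,
`Σᶠ_{q ∈ Fix_γ(Γ ⧸ Kv)} φ (q.out⁻¹ γ q.out) = Σᶠ_{x ∈ Fix_W(γ)} φ ((s x)⁻¹ γ (s x))`. [cite: Kottwitz1986, §3] [cite: Rogawski1990, §4.9 p. 54] -/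
theorem finsum_mem_fixedBy_quotient_conj_eq_finsum_fixedPoints_section_of_vertexAction {E : Type*} [AddCommMonoid E] (φ : Γ → E)
    (hφK : ∀ k ∈ Kv, ∀ y : Γ, φ (k * y * k⁻¹) = φ y) (s : W → Γ) (hsec : ∀ x : W, act (s x) x₀ = x) :
    ∑ᶠ q ∈ fixedBy (Γ ⧸ Kv) γ, φ (q.out⁻¹ * γ * q.out) = ∑ᶠ x ∈ {x : W | act γ x = x}, φ ((s x)⁻¹ * γ * s x) :=
  finsum_mem_fixedBy_quotient_conj_eq_finsum_fixedPoints_section Kv γ (fun g => act g x₀)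
    (act_apply_eq_act_apply_iff_inv_mul_mem act act_one act_mul Kv hKv) hV (act γ) (fun g => act_mul γ g x₀) φ hφK s hsec

include act_one act_mul hV hKv in
/-- Finitely many fixed cosets in `Γ ⧸ Kv` iff finitely many fixed vertices. [cite: Serre1980Trees, I.6.1] -/
theorem finite_fixedBy_quotient_iff_of_vertexAction : (fixedBy (Γ ⧸ Kv) γ).Finite ↔ {x : W | act γ x = x}.Finite :=
  finite_fixedBy_quotient_iff_orbitMap Kv γ (fun g => act g x₀) (act_apply_eq_act_apply_iff_inv_mul_mem act act_one act_mul Kv hKv) hV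
    (act γ) (fun g => act_mul γ g x₀)

include act_one act_mul hV hKv in
/-- `#Fix_γ(Γ ⧸ Kv) = #Fix_W(γ)` (`Set.ncard`). [cite: Serre1980Trees, I.6.1] [cite: Kottwitz1986, §3] -/
theorem ncard_fixedBy_quotient_eq_of_vertexAction : (fixedBy (Γ ⧸ Kv) γ).ncard = {x : W | act γ x = x}.ncard :=
  ncard_fixedBy_quotient_eq_orbitMap Kv γ (fun g => act g x₀) (act_apply_eq_act_apply_iff_inv_mul_mem act act_one act_mul Kv hKv) hV
    (act γ) (fun g => act_mul γ g x₀)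

include act_one act_mul hV hKv in
/-- Stratified vertex counts: `#{q ∈ Fix_γ(Γ ⧸ Kv) | pr (act q.out x₀)} = #{x ∈ Fix_W(γ) | pr x}` (e.g. `pr x ↔ d x = i`, a shell of the tree).
[cite: Kottwitz1986, §3] [cite: LabesseLanglands1979, §2 p. 8] -/
theorem ncard_sep_fixedBy_quotient_eq_of_vertexAction (pr : W → Prop) :
    {q ∈ fixedBy (Γ ⧸ Kv) γ | pr (act q.out x₀)}.ncard = {x : W | act γ x = x ∧ pr x}.ncard :=
  ncard_sep_fixedBy_quotient_eq_orbitMap Kv γ (fun g => act g x₀) (act_apply_eq_act_apply_iff_inv_mul_mem act act_one act_mul Kv hKv) hV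
    (act γ) (fun g => act_mul γ g x₀) pr

end Vertex

/-! ### §2.2 Geometric edges: `Ke = Stab{x₀, x₁}` (set-wise), one dart orbit -/

section Edge

variable {X : SimpleGraph W} (act_adj : ∀ (g : Γ) (a b : W), X.Adj (act g a) (act g b) ↔ X.Adj a b)
  {x₀ x₁ : W} (h01 : X.Adj x₀ x₁) (hD : ∀ a b : W, X.Adj a b → ∃ g : Γ, act g x₀ = a ∧ act g x₁ = b)
  (Ke : Subgroup Γ) (hKe : ∀ g : Γ, g ∈ Ke ↔ s(act g x₀, act g x₁) = s(x₀, x₁)) (γ : Γ)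

omit [Group Γ] in
include act_adj in
/-- A group acting on a graph by automorphisms of the vertex set maps edges to edges. [cite: Serre1980Trees, I.2.1] -/
theorem sym2Mk_act_mem_edgeSet (g : Γ) {a b : W} (hab : X.Adj a b) : s(act g a, act g b) ∈ X.edgeSet :=
  (SimpleGraph.mem_edgeSet _).2 ((act_adj g a b).2 hab)

omit [Group Γ] in
include act_adj in
/-- A group acting on a graph by automorphisms maps the edge set to itself (`Sym2.map (act g)`). [cite: Serre1980Trees, I.2.1] -/
theorem sym2Map_act_mem_edgeSet (g : Γ) (e : X.edgeSet) : Sym2.map (act g) (e : Sym2 W) ∈ X.edgeSet := by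
  obtain ⟨e, he⟩ := e
  induction e using Sym2.ind with
  | h a b => rw [Sym2.map_mk]; exact sym2Mk_act_mem_edgeSet act act_adj g ((SimpleGraph.mem_edgeSet _).1 he)

include act_one act_mul in
/-- Bookkeeping (private): `act a` is injective on unordered pairs. [folklore] -/
private theorem sym2Mk_act_eq_sym2Mk_act_iff (a : Γ) (x y x' y' : W) : s(act a x, act a y) = s(act a x', act a y') ↔ s(x, y) = s(x', y') := by
  rw [← Sym2.map_mk (f := act a) x y, ← Sym2.map_mk (f := act a) x' y']
  exact (Sym2.map.injective (injective_act_of_act_one_act_mul act act_one act_mul a)).eq_iff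

include act_one act_mul hKe in
/-- The edge orbit map `g ↦ {act g x₀, act g x₁}` has `Ke`-fibres. [cite: Serre1980Trees, I.6.1] -/
theorem edgeOrbitMap_eq_iff_inv_mul_mem (a b : Γ) :
    (⟨s(act a x₀, act a x₁), sym2Mk_act_mem_edgeSet act act_adj a h01⟩ : X.edgeSet) =
      ⟨s(act b x₀, act b x₁), sym2Mk_act_mem_edgeSet act act_adj b h01⟩ ↔ a⁻¹ * b ∈ Ke := by
  rw [hKe, Subtype.ext_iff]
  show s(act a x₀, act a x₁) = s(act b x₀, act b x₁) ↔ s(act (a⁻¹ * b) x₀, act (a⁻¹ * b) x₁) = s(x₀, x₁)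
  rw [← sym2Mk_act_eq_sym2Mk_act_iff act act_one act_mul a (act (a⁻¹ * b) x₀) (act (a⁻¹ * b) x₁) x₀ x₁, ← act_mul, ← act_mul,
    mul_inv_cancel_left]
  exact eq_comm

omit [Group Γ] in
include hD in
/-- The edge orbit map is onto the edge set (one dart orbit). [cite: Serre1980Trees, I.6.1; II.1.2–1.3] -/
theorem edgeOrbitMap_surjective :
    Function.Surjective fun g : Γ => (⟨s(act g x₀, act g x₁), sym2Mk_act_mem_edgeSet act act_adj g h01⟩ : X.edgeSet) := by
  rintro ⟨e, he⟩
  induction e using Sym2.ind with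
  | h a b =>
    obtain ⟨g, hga, hgb⟩ := hD a b ((SimpleGraph.mem_edgeSet _).1 he)
    exact ⟨g, Subtype.ext (by simp only [hga, hgb])⟩

include act_mul in
/-- The edge orbit map intertwines `γ` with `Sym2.map (act γ)`. [cite: Serre1980Trees, I.6.1] -/
theorem edgeOrbitMap_mul (g : Γ) :
    (⟨s(act (γ * g) x₀, act (γ * g) x₁), sym2Mk_act_mem_edgeSet act act_adj (γ * g) h01⟩ : X.edgeSet) =
      ⟨Sym2.map (act γ) (s(act g x₀, act g x₁) : Sym2 W),
        sym2Map_act_mem_edgeSet act act_adj γ ⟨s(act g x₀, act g x₁), sym2Mk_act_mem_edgeSet act act_adj g h01⟩⟩ :=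
  Subtype.ext (by
    show s(act (γ * g) x₀, act (γ * g) x₁) = Sym2.map (act γ) s(act g x₀, act g x₁)
    rw [Sym2.map_mk, act_mul, act_mul])

omit [Group Γ] in
/-- Bookkeeping (private): the fixed points of `Sym2.map (act γ)` on the edge subtype are the set-wise fixed edges. [folklore] -/
private theorem setOf_sym2Map_act_subtype_eq :
    {e : X.edgeSet | (⟨Sym2.map (act γ) (e : Sym2 W), sym2Map_act_mem_edgeSet act act_adj γ e⟩ : X.edgeSet) = e} =
      {e : X.edgeSet | Sym2.map (act γ) (e : Sym2 W) = e} :=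
  Set.ext fun _ => Subtype.ext_iff

include act_one act_mul act_adj hD hKe in
/-- **THE WEIGHTED FIXED-POINT SUM READ ON THE GEOMETRIC EDGES** (value-law form): with `T = Sym2.map (act γ)` on `X.edgeSet`, if
`φ (g⁻¹ γ g) = val ⟨s(act g x₀, act g x₁), _⟩` whenever `γ` fixes the edge `{act g x₀, act g x₁}` SET-WISE (it may invert it), then
`Σᶠ_{q ∈ Fix_γ(Γ ⧸ Ke)} φ (q.out⁻¹ γ q.out) = Σᶠ_{e ∈ E(X), γ·e = e} val e`. [cite: Kottwitz1986, §3] [cite: Serre1980Trees, I.6.1; II.1.2–1.3] -/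
theorem finsum_mem_fixedBy_quotient_conj_eq_finsum_fixedEdges_of_edgeAction {E : Type*} [AddCommMonoid E] (φ : Γ → E) (val : X.edgeSet → E)
    (hval : ∀ g : Γ, Sym2.map (act γ) s(act g x₀, act g x₁) = s(act g x₀, act g x₁) →
      φ (g⁻¹ * γ * g) = val ⟨s(act g x₀, act g x₁), sym2Mk_act_mem_edgeSet act act_adj g h01⟩) :
    ∑ᶠ q ∈ fixedBy (Γ ⧸ Ke) γ, φ (q.out⁻¹ * γ * q.out) = ∑ᶠ e ∈ {e : X.edgeSet | Sym2.map (act γ) (e : Sym2 W) = e}, val e := by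
  rw [← setOf_sym2Map_act_subtype_eq act act_adj γ]
  exact finsum_mem_fixedBy_quotient_conj_eq_finsum_fixedPoints Ke γ
    (fun g : Γ => (⟨s(act g x₀, act g x₁), sym2Mk_act_mem_edgeSet act act_adj g h01⟩ : X.edgeSet))
    (edgeOrbitMap_eq_iff_inv_mul_mem act act_one act_mul act_adj h01 Ke hKe) (edgeOrbitMap_surjective act act_adj h01 hD)
    (fun e : X.edgeSet => (⟨Sym2.map (act γ) (e : Sym2 W), sym2Map_act_mem_edgeSet act act_adj γ e⟩ : X.edgeSet))
    (edgeOrbitMap_mul act act_mul act_adj h01 γ) φ val (fun g hg => hval g (Subtype.ext_iff.1 hg))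

include act_one act_mul act_adj h01 hD hKe in
/-- Finitely many fixed cosets in `Γ ⧸ Ke` iff finitely many set-wise fixed edges. [cite: Serre1980Trees, I.6.1] -/
theorem finite_fixedBy_quotient_iff_of_edgeAction :
    (fixedBy (Γ ⧸ Ke) γ).Finite ↔ {e : X.edgeSet | Sym2.map (act γ) (e : Sym2 W) = e}.Finite := by
  rw [← setOf_sym2Map_act_subtype_eq act act_adj γ]
  exact finite_fixedBy_quotient_iff_orbitMap Ke γ
    (fun g : Γ => (⟨s(act g x₀, act g x₁), sym2Mk_act_mem_edgeSet act act_adj g h01⟩ : X.edgeSet))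
    (edgeOrbitMap_eq_iff_inv_mul_mem act act_one act_mul act_adj h01 Ke hKe) (edgeOrbitMap_surjective act act_adj h01 hD)
    (fun e : X.edgeSet => (⟨Sym2.map (act γ) (e : Sym2 W), sym2Map_act_mem_edgeSet act act_adj γ e⟩ : X.edgeSet))
    (edgeOrbitMap_mul act act_mul act_adj h01 γ)

include act_one act_mul act_adj h01 hD hKe in
/-- `#Fix_γ(Γ ⧸ Ke) = #{e ∈ E(X) | γ·e = e}` (set-wise fixed edges, `Set.ncard`). [cite: Serre1980Trees, I.6.1] [cite: Kottwitz1986, §3] -/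
theorem ncard_fixedBy_quotient_eq_of_edgeAction :
    (fixedBy (Γ ⧸ Ke) γ).ncard = {e : X.edgeSet | Sym2.map (act γ) (e : Sym2 W) = e}.ncard := by
  rw [← setOf_sym2Map_act_subtype_eq act act_adj γ]
  exact ncard_fixedBy_quotient_eq_orbitMap Ke γ
    (fun g : Γ => (⟨s(act g x₀, act g x₁), sym2Mk_act_mem_edgeSet act act_adj g h01⟩ : X.edgeSet))
    (edgeOrbitMap_eq_iff_inv_mul_mem act act_one act_mul act_adj h01 Ke hKe) (edgeOrbitMap_surjective act act_adj h01 hD)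
    (fun e : X.edgeSet => (⟨Sym2.map (act γ) (e : Sym2 W), sym2Map_act_mem_edgeSet act act_adj γ e⟩ : X.edgeSet))
    (edgeOrbitMap_mul act act_mul act_adj h01 γ)

end Edge

end Action

end Literature.GroupTheory
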